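import Literature.AnabelianGeometry.EtaleTheta.SettingModelTateInstance
import Literature.AnabelianGeometry.EtaleTheta.SettingModelTateThetaOddShear
import Literature.AnabelianGeometry.EtaleTheta.SettingModelKummerCocycleNegOne
import Literature.AnabelianGeometry.EtaleTheta.SettingModelChiKummerData
import HarnessLib

/-!
# The stage-2 model of the [EtTh] §1 root: the fields `K̈_N = K_{2N}` in the Kummer-cocycle currency
# (`G_{K̈_N} = {χ_{2N} = 1 ∧ κ_p ≡ 0 (N)} = Ker_N(κ_{−1}) ∩ Ker_N(κ_p)`)

Mochizuki, *The étale theta function …*, Publ. RIMS **45** (2009) [EtTh], §1, PRIMS PDF p. 17: "`K̈_N := K_{2N}`",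
"`K̈ = K(ζ₂, q_X^{1/2})`", the coverings `Ÿ_N → Ÿ` [cite: MochizukiEtTh2009, §1 p.17]; J. Neukirch, *Algebraic Number
Theory*, Ch. IV §3 [cite: NeukirchANT1999, Ch. IV §3]. abc-iut cell, layer L2, seat abc-iut-L2-t5 (gen 6; Tate-curve /
Kummer lineage), R78 cluster STAGE 2 — PROOF-ONLY sequel of F5q (`SettingModelTateTheta.mem_GKNq_iff`:
`G_{K_N} = {χ_N = 1 ∧ κ_p² ≡ 0 (N)}` at `q_X = p²`) at the DOUBLED levels that index the `Ÿ`-side objects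
(`ThetaSetting.GKddN N := GKN (2N)`): since `level_{2N}(κ²) = 1 ↔ level_N(κ) = 1` in `Ẑ` (torsion-free, squaring
injective — abc-iut-w5-d171's `sqHom_injective`), the `2`-torsion subtlety of `G_{K_N}` disappears for `K̈_N`:

* `level_two_mul_sq_eq_one_iff` — `ZHatLevel.level (2N) (z²) = 1 ↔ ZHatLevel.level N z = 1`;
* **`mem_GKddNq_iff`** — `σ ∈ G_{K̈_N}` (`= (fieldKN ⊥ (qModel p) (2N)).fixingSubgroup`) iff
  `χ_{2N}(σ) = 1 ∧ κ_p(σ) ≡ 0 (N)`, i.e. `K̈_N = ℚ_p(μ_{2N}, p^{1/N})`;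
* **`mem_GKddNq_iff_kappaNegOne`** — equivalently `κ_{−1}(σ) ≡ 0 (N) ∧ κ_p(σ) ≡ 0 (N)` (this lineage's
  `level_kappaNegOne_eq_one_iff`): `G_{K̈_N}` is the joint level-`N` kernel of the two Kummer cocycles of `−1` and
  `q̈ = p`;
* record forms `mem_GKddN_modelTate_iff`, `mem_GKddN_modelχq_iff`.

HONEST LABEL: classical Kummer theory inside a semi-synthetic model (consistency evidence only); nothing of [EtTh] is
asserted; nothing here bears on [IUTchIII] Cor. 3.12. PROOF-ONLY (0 definitions).
-/

noncomputable section

namespace Literature.AnabelianGeometry.EtaleTheta.SettingModel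

open Literature.AnabelianGeometry.SemiGraphs (GQp)

variable (p : ℕ) [Fact p.Prime]

/-- In `Ẑ`: `z²` dies at level `2N` iff `z` dies at level `N` (`s^{2N} = z² ⇒ z = s^N` by injectivity of
squaring). [cite: RibesZalesskii2010, Thm 2.7.1] -/
theorem level_two_mul_sq_eq_one_iff (N : ℕ+) (z : ZH) :
    ZHatLevel.level (2 * N) (z ^ 2) = 1 ↔ ZHatLevel.level N z = 1 := by
  have h2N : ((2 * N : ℕ+) : ℕ) = (N : ℕ) * 2 := by rw [PNat.mul_coe, Nat.mul_comm]; rfl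
  rw [ZHatLevel.level_eq_one_iff_exists_pow, ZHatLevel.level_eq_one_iff_exists_pow]
  constructor
  · rintro ⟨s, hs⟩
    refine ⟨s, sqHom_injective ?_⟩
    rw [sqHom_apply, sqHom_apply, ← pow_mul, ← h2N, hs]
  · rintro ⟨s, rfl⟩
    exact ⟨s, by rw [← pow_mul, h2N]⟩

/-- **`G_{K̈_N} = {χ_{2N} = 1 ∧ κ_p ≡ 0 (N)}`** for `K̈_N = K_{2N} = ℚ_p(μ_{2N}, (p²)^{1/2N}) = ℚ_p(μ_{2N}, p^{1/N})`:
at the doubled level the Kummer condition is on `κ_p` itself. [cite: MochizukiEtTh2009, §1 p.17] -/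
theorem mem_GKddNq_iff (σ : GQp p) (N : ℕ+) :
    σ ∈ (fieldKN ⊥ (qModel p) (2 * N)).fixingSubgroup ↔
      ZHatLevel.levelChar (2 * N) (chi p σ) = 1 ∧ ZHatLevel.level N (kappaP p σ) = 1 := by
  rw [mem_GKNq_iff, level_two_mul_sq_eq_one_iff]

/-- **`G_{K̈_N}` is the joint level-`N` kernel of `κ_{−1}` and `κ_p`** (`χ_{2N}(σ) = 1 ↔ κ_{−1}(σ) ≡ 0 (N)`,
`level_kappaNegOne_eq_one_iff`): `K̈_N = ℚ_p(ξ_{2N}, p^{1/N})` with `ξ_{2N} = (−1)^{1/N}`.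
[cite: MochizukiEtTh2009, §1 p.17] -/
theorem mem_GKddNq_iff_kappaNegOne (σ : GQp p) (N : ℕ+) :
    σ ∈ (fieldKN ⊥ (qModel p) (2 * N)).fixingSubgroup ↔
      ZHatLevel.level N (kappaNegOne p σ) = 1 ∧ ZHatLevel.level N (kappaP p σ) = 1 := by
  rw [mem_GKddNq_iff, level_kappaNegOne_eq_one_iff]

/-- Record form at the Tate instance: `σ ∈ (modelTate p).GKddN N ↔ χ_{2N}(σ) = 1 ∧ κ_p(σ) ≡ 0 (N)`.
[cite: MochizukiEtTh2009, §1 p.17] -/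
theorem mem_GKddN_modelTate_iff (σ : GQp p) (N : ℕ+) :
    σ ∈ (ThetaSetting.modelTate p).GKddN N ↔
      ZHatLevel.levelChar (2 * N) (chi p σ) = 1 ∧ ZHatLevel.level N (kappaP p σ) = 1 :=
  mem_GKddNq_iff p σ N

/-- Record form for every stage-2 record `modelχq p i j hj`. [cite: MochizukiEtTh2009, §1 p.17] -/
theorem mem_GKddN_modelχq_iff (i j : ℤ) (hj : Even j) (σ : GQp p) (N : ℕ+) :
    σ ∈ (ThetaSetting.modelχq p i j hj).GKddN N ↔
      ZHatLevel.levelChar (2 * N) (chi p σ) = 1 ∧ ZHatLevel.level N (kappaP p σ) = 1 :=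
  mem_GKddNq_iff p σ N

/-- `G_K̈ = G_{K̈_1}`-sanity: at `N = 1` both conditions are empty (`level 1 ≡ 1`), recovering
`G_K̈ = G_{K_2} = G_{ℚ_p}`. [cite: MochizukiEtTh2009, §1 p.17] -/
theorem mem_GKddN_modelTate_one (σ : GQp p) : σ ∈ (ThetaSetting.modelTate p).GKddN 1 := by
  show σ ∈ (fieldKN ⊥ (qModel p) (2 * 1)).fixingSubgroup
  rw [mul_one, fixingSubgroup_fieldKN_qModel_two_eq_top]
  exact Subgroup.mem_top σ

end Literature.AnabelianGeometry.EtaleTheta.SettingModel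

end
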